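import Literature.Computability.Complexity.IrreducibilityLLLPolyArith
import Literature.Algebra.EuclideanLattices.KhotParamsFP
import HarnessLib

/-!
# Polynomial arithmetic modulo `M` on coefficient lists runs in polynomial time (`CodeFP`)

Support file for the discharge of the named fact
`Literature.Computability.Complexity.lll_monicIrreducible_mem_P` (irreducibility of monic integer
polynomials is decidable in `P`; Lenstra–Lenstra–Lovász 1982, §3). Machine side of
`IrreducibilityLLLPolyArith.lean`: each list program there is computed on codes by a
polynomial-time string function, in the typed `FP` algebra `CodeFP` (`CodeFP.lean`,
`CodeFPArith.lean`, `SumcheckPolyArith.lean`): coefficient lists are `rawE intE`, moduli `natE`.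

Totality discipline. A `CodeFP` statement is about a function on ALL inputs, so every iterated
program is typed through a variant which is polynomially bounded also on junk: the modulus `M` is
replaced by `M⁺ = max M 2` (so that reduced entries stay below a bound read off the input), which
is the identity on every intended run (`M = p` or `p^k`, `≥ 2`):

* `pmodC` (integer remainder on codes is the tree's `Khot.intEMod`), `psubC`, `lastEntryC`, `trimC` (trim as a left fold carrying the pending zeros,
  `trim_eq_foldl`), `pnormC`;
* `divStepC`; the unconditional invariants of the division loop (`length_divRun_le`,
  `reduced_divRun`) and **`pdivmodC`**: `(M, a, b) ↦ pdivmod M⁺ a b` (accumulator bound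
  `60 (L+1)²`); `pmulMC`, `pmodMC`;
* the size lemma behind all accumulator bounds: `length_rawE_intE_le_of_reduced` (a reduced list
  of length `k` codes in `≤ k (6 (size k + size M) + 6)` symbols).

## References

* S. Arora, B. Barak, *Computational Complexity: A Modern Approach*, CUP 2009, §1.3 (polynomial
  time is closed under composition and polynomially bounded loops). [AroraBarak2009]
* D. E. Knuth, *The Art of Computer Programming*, Vol. 2, §4.6.1, Algorithm D. [KnuthTAOCP2]
* A. K. Lenstra, H. W. Lenstra Jr., L. Lovász, Math. Ann. 261 (1982), §3, proof of (3.6) (all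
  arithmetic is on integers of polynomially bounded length). [LenstraLenstraLovasz1982]
-/

noncomputable section

namespace Literature.Computability.Complexity

open Polynomial SumcheckMA CodeFP Brick _root_.Computability

namespace LLLFactoring

/-! ### Code lengths of reduced lists -/

/-- The `ℓ¹` norm of a reduced list: `‖r‖₁ ≤ |r| · M`. [folklore] -/
theorem l1_le_of_reduced {M : ℕ} {r : List ℤ} (hr : Reduced M r) : l1 r ≤ r.length * M := by
  unfold l1
  have : ∀ x ∈ r.map Int.natAbs, x ≤ M := fun x hx => by
    obtain ⟨c, hc, rfl⟩ := List.mem_map.1 hx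
    have := hr c hc
    omega
  simpa using List.sum_le_card_nsmul _ _ this

/-- **The code of a reduced list**: `≤ |r| (6 (size |r| + size M) + 6)`. [folklore] -/
theorem length_rawE_intE_le_of_reduced {M : ℕ} {r : List ℤ} (hr : Reduced M r) :
    (rawE intE r).length ≤ r.length * (6 * (Nat.size r.length + Nat.size M) + 6) := by
  refine (length_rawE_intE_le r).trans (Nat.mul_le_mul_left _ ?_)
  have := (size_mono (l1_le_of_reduced hr)).trans (size_mul_le r.length M)
  omega

/-- `size (max M 2) ≤ size M + 2`. [folklore] -/
theorem size_max_two_le (M : ℕ) : Nat.size (max M 2) ≤ Nat.size M + 2 := by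
  rcases le_total M 2 with h | h
  · rw [max_eq_right h]; have : Nat.size 2 = 2 := by decide
    omega
  · rw [max_eq_left h]; omega

/-- The item list is not longer than its code. [folklore] -/
theorem length_le_code (r : List ℤ) : r.length ≤ (rawE intE r).length := length_le_length_rawE intE r

/-! ### Coefficientwise operations -/

/-- `max M 2` on codes. [folklore] -/
theorem maxTwoC : CodeFP natE natE (fun M => max M 2) := natMax.comp ((CodeFP.id natE).pair (const natE 2))

/-- **`pmod`** on codes: `(M, a) ↦ a mod M` coefficientwise. [cite: AroraBarak2009, §1.3] -/
theorem pmodC : CodeFP (pairE natE (rawE intE)) (rawE intE) (fun p => pmod p.1 p.2) :=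
  (map (σ := ℕ) (eσ := natE) (g := fun t : ℕ × ℤ => t.2 % (t.1 : ℤ))
    (Literature.Algebra.EuclideanLattices.Khot.intEMod.comp ((snd _ _).pair (intOfNat.comp (fst _ _))))).congr fun _ => rfl

/-- **`psub`** on codes. [cite: AroraBarak2009, §1.3] -/
theorem psubC : CodeFP (pairE (rawE intE) (rawE intE)) (rawE intE) (fun p => psub p.1 p.2) :=
  (paddC.comp ((fst _ _).pair (pscaleC.comp ((const _ (-1 : ℤ)).pair (snd _ _))))).congr fun _ => rfl

/-- The top entry read through `getD`. [folklore] -/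
theorem getLast?_getD_eq_getD (r : List ℤ) : r.getLast?.getD 0 = r.getD (r.length - 1) 0 := by
  rcases r.eq_nil_or_concat' with rfl | ⟨l, c, rfl⟩
  · rfl
  · rw [List.getLast?_concat, Option.getD_some, List.length_append, List.length_singleton, Nat.add_sub_cancel,
      List.getD_eq_getElem _ _ (by simp), List.getElem_append_right (le_refl _)]
    simp

/-- **The top entry** `last a` (`0` on `[]`) on codes. [folklore] -/
theorem lastEntryC : CodeFP (rawE intE) intE (fun r => r.getLast?.getD 0) :=
  ((rawGetOr intE).comp ((CodeFP.id _).pair ((natSub.comp ((natLength intE).pair (const _ 1))).pair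
    (const _ (0 : ℤ))))).congr fun r => by simp only [id]; rw [getLast?_getD_eq_getD]

/-! ### Trailing zeros by a left fold -/

/-- One step of the trimming fold on `(kept, pending zeros)`. [folklore] -/
def trimStep (st : List ℤ × ℕ) (x : ℤ) : List ℤ × ℕ :=
  if x = 0 then (st.1, st.2 + 1) else (st.1 ++ List.replicate st.2 0 ++ [x], 0)

/-- A list is its trimmed part followed by the dropped zeros. [folklore] -/
theorem trim_append_replicate (a : List ℤ) : trim a ++ List.replicate (a.length - (trim a).length) 0 = a := by
  induction a using List.reverseRecOn with
  | nil => simp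
  | append_singleton a c ih =>
    rw [trim_concat]
    split_ifs with h
    · subst h
      have hle := length_trim_le a
      rw [List.length_append, List.length_singleton, show a.length + 1 - (trim a).length = (a.length - (trim a).length) + 1 by omega,
        List.replicate_succ', ← List.append_assoc, ih]
    · simp

/-- **`trim` is the trimming fold.** [folklore] -/
theorem trim_eq_foldl (a : List ℤ) : a.foldl trimStep ([], 0) = (trim a, a.length - (trim a).length) := by
  induction a using List.reverseRecOn with
  | nil => simp
  | append_singleton a c ih =>
    rw [List.foldl_append, ih, List.foldl_cons, List.foldl_nil, trimStep, trim_concat]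
    split_ifs with h
    · simp only [List.length_append, List.length_singleton]
      have := length_trim_le a
      congr 1; omega
    · simp only [List.length_append, List.length_singleton, Nat.sub_self]
      rw [trim_append_replicate]

/-- **`trim`** on codes (accumulator: a prefix of the input and a unary counter below its length).
[cite: AroraBarak2009, §1.3] -/
theorem trimC : CodeFP (rawE intE) (rawE intE) trim := by
  have hx0 : CodeFP (pairE intE (pairE (rawE intE) unE)) bitE (fun t => decide (t.1 = 0)) :=
    intEq.comp ((fst _ _).pair (const _ (0 : ℤ)))
  have hkept : CodeFP (pairE intE (pairE (rawE intE) unE)) (rawE intE) (fun t => t.2.1) := (snd _ _).fst'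
  have hpend : CodeFP (pairE intE (pairE (rawE intE) unE)) unE (fun t => t.2.2) := (snd _ _).snd'
  have hx : CodeFP (pairE intE (pairE (rawE intE) unE)) intE (fun t => t.1) := fst _ _
  have hzero : CodeFP (pairE intE (pairE (rawE intE) unE)) (pairE (rawE intE) unE) (fun t => (t.2.1, t.2.2 + 1)) :=
    hkept.pair (unSucc.comp hpend)
  have hnz : CodeFP (pairE intE (pairE (rawE intE) unE)) (pairE (rawE intE) unE)
      (fun t => (t.2.1 ++ List.replicate t.2.2 0 ++ [t.1], 0)) :=
    ((rawAppend intE).comp (((rawAppend intE).comp (hkept.pair ((replicateOf intE).comp ((const _ (0 : ℤ)).pair hpend)))).pair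
      ((rawSingleton intE).comp hx))).pair (const _ 0)
  have hstep : CodeFP (pairE intE (pairE (rawE intE) unE)) (pairE (rawE intE) unE) (fun t => trimStep t.2 t.1) :=
    (hx0.ite hzero hnz).congr fun t => by
      unfold trimStep
      by_cases h : t.1 = 0 <;> simp [h]
  have h := foldl₀ (eα := intE) (eβ := pairE (rawE intE) unE) (step := fun x st => trimStep st x) (b₀ := ([], 0)) hstep
    (3 * X + 2) (fun l₁ l₂ => by
      rw [show (l₁.foldl (fun b a => trimStep b a) ([], 0)) = l₁.foldl trimStep ([], 0) from rfl, trim_eq_foldl]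
      simp only [pairE_apply, length_boolPair, length_unE, eval_add, eval_mul, eval_ofNat, eval_X]
      have h1 : (rawE intE (trim l₁)).length ≤ (rawE intE (l₁ ++ l₂)).length :=
        length_rawE_le_of_sublist intE ((trim_prefix l₁).sublist.trans (List.sublist_append_left l₁ l₂))
      have h2 : l₁.length ≤ (rawE intE (l₁ ++ l₂)).length :=
        (List.sublist_append_left l₁ l₂).length_le.trans (length_le_code _)
      omega)
  exact ((fst _ _).comp h).congr fun l => by
    show (l.foldl (fun b a => trimStep b a) ([], 0)).1 = trim l
    rw [show (l.foldl (fun b a => trimStep b a) ([], 0)) = l.foldl trimStep ([], 0) from rfl, trim_eq_foldl]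

/-- **`pnorm`** on codes. [cite: AroraBarak2009, §1.3] -/
theorem pnormC : CodeFP (pairE natE (rawE intE)) (rawE intE) (fun p => pnorm p.1 p.2) :=
  (trimC.comp pmodC).congr fun _ => rfl

/-! ### The division step and loop -/

/-- **One division step** on codes (context `(M, b)`, state `(q, r)`). [cite: KnuthTAOCP2, §4.6.1, Algorithm D] -/
theorem divStepC : CodeFP (pairE (pairE natE (rawE intE)) (pairE (rawE intE) (rawE intE))) (pairE (rawE intE) (rawE intE))
    (fun t => divStep t.1.1 t.1.2 t.2) := by
  -- projections
  have hM : CodeFP (pairE (pairE natE (rawE intE)) (pairE (rawE intE) (rawE intE))) natE (fun t => t.1.1) := (fst _ _).fst'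
  have hb : CodeFP (pairE (pairE natE (rawE intE)) (pairE (rawE intE) (rawE intE))) (rawE intE) (fun t => t.1.2) := (fst _ _).snd'
  have hq : CodeFP (pairE (pairE natE (rawE intE)) (pairE (rawE intE) (rawE intE))) (rawE intE) (fun t => t.2.1) := (snd _ _).fst'
  have hr : CodeFP (pairE (pairE natE (rawE intE)) (pairE (rawE intE) (rawE intE))) (rawE intE) (fun t => t.2.2) := (snd _ _).snd'
  -- the test `|r| < |b|`
  have htest : CodeFP (pairE (pairE natE (rawE intE)) (pairE (rawE intE) (rawE intE))) bitE
      (fun t => decide (t.2.2.length < t.1.2.length)) :=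
    natLt.comp (((natLength intE).comp hr).pair ((natLength intE).comp hb))
  -- the top entry `c` and the shift `s = |r| - |b|` (unary)
  have hc : CodeFP (pairE (pairE natE (rawE intE)) (pairE (rawE intE) (rawE intE))) intE (fun t => t.2.2.getLast?.getD 0) :=
    lastEntryC.comp hr
  have hs : CodeFP (pairE (pairE natE (rawE intE)) (pairE (rawE intE) (rawE intE))) unE (fun t => t.2.2.length - t.1.2.length) :=
    (unSubLen intE).comp (((ulength intE).comp hr).pair hb)
  -- `t = pmod M (psub r (0^s ++ c • b))`
  have ht : CodeFP (pairE (pairE natE (rawE intE)) (pairE (rawE intE) (rawE intE))) (rawE intE)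
      (fun t => pmod t.1.1 (psub t.2.2 (pshift (t.2.2.length - t.1.2.length) (pscale (t.2.2.getLast?.getD 0) t.1.2)))) :=
    pmodC.comp (hM.pair (psubC.comp (hr.pair ((rawAppend intE).comp
      (((replicateOf intE).comp ((const _ (0 : ℤ)).pair hs)).pair (pscaleC.comp (hc.pair hb)))))))
  -- `dropLast = take (|t| - 1)`
  have hdrop : CodeFP (rawE intE) (rawE intE) List.dropLast :=
    ((rawTakeUn intE).comp ((unOfNatMin.comp ((ulength intE).pair (natSub.comp ((natLength intE).pair (const _ 1))))).pair
      (CodeFP.id _))).congr fun l => by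
        simp only [id]
        rw [min_eq_left (Nat.sub_le _ _), List.dropLast_eq_take]
  have hact : CodeFP (pairE (pairE natE (rawE intE)) (pairE (rawE intE) (rawE intE))) (pairE (rawE intE) (rawE intE))
      (fun t => (t.2.2.getLast?.getD 0 :: t.2.1,
        (pmod t.1.1 (psub t.2.2 (pshift (t.2.2.length - t.1.2.length) (pscale (t.2.2.getLast?.getD 0) t.1.2)))).dropLast)) :=
    ((rawCons intE).comp (hc.pair hq)).pair (hdrop.comp ht)
  refine (htest.ite (snd _ _) hact).congr fun t => ?_
  by_cases h : t.2.2.length < t.1.2.length <;> simp [divStep, h]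

/-- The state of the division loop after a list of idle ticks. [folklore] -/
theorem foldl_divStep_eq (M : ℕ) (b : List ℤ) (u : List Unit) (st : List ℤ × List ℤ) :
    u.foldl (fun st _ => divStep M b st) st = (List.replicate u.length ()).foldl (fun st _ => divStep M b st) st := by
  rw [CodeFP.eq_replicate_unit u]; simp

/-- **Unconditional length bounds of one division step**: the remainder never lengthens, the
quotient gains at most one digit. [folklore] -/
theorem length_divStep_le (M : ℕ) (b : List ℤ) (st : List ℤ × List ℤ) :
    (divStep M b st).2.length ≤ st.2.length ∧ (divStep M b st).1.length ≤ st.1.length + 1 := by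
  unfold divStep
  split_ifs with h
  · exact ⟨le_rfl, Nat.le_succ _⟩
  · constructor
    · show (List.dropLast _).length ≤ _
      rw [List.length_dropLast, length_pmod, length_psub, SumcheckMA.length_pshift_pscale]; omega
    · show (List.cons _ _).length ≤ _
      rw [List.length_cons]

/-- Along any run from `([], pmod M a)`: `|r| ≤ |a|` and `|q| ≤` the number of ticks. [folklore] -/
theorem length_divRun_le (M : ℕ) (a b : List ℤ) : ∀ u : List Unit,
    (u.foldl (fun st _ => divStep M b st) ([], pmod M a)).2.length ≤ a.length ∧
      (u.foldl (fun st _ => divStep M b st) ([], pmod M a)).1.length ≤ u.length := by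
  intro u
  induction u using List.reverseRecOn with
  | nil => simp
  | append_singleton u x ih =>
    rw [List.foldl_append, List.foldl_cons, List.foldl_nil, List.length_append, List.length_singleton]
    have h := length_divStep_le M b (u.foldl (fun st _ => divStep M b st) ([], pmod M a))
    exact ⟨h.1.trans ih.1, h.2.trans (by omega)⟩

/-- **Unconditional reducedness** along the loop (`M ≥ 1`): the quotient digits are entries of the
remainder, the remainder is reduced every step. [folklore] -/
theorem reduced_divStep {M : ℕ} (hM : 0 < M) (b : List ℤ) {st : List ℤ × List ℤ} (hq : Reduced M st.1) (hr : Reduced M st.2) :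
    Reduced M (divStep M b st).1 ∧ Reduced M (divStep M b st).2 := by
  unfold divStep
  split_ifs with h
  · exact ⟨hq, hr⟩
  · refine ⟨fun x hx => ?_, (reduced_pmod hM _).of_subset (List.dropLast_subset _)⟩
    rcases List.mem_cons.1 hx with rfl | hx
    · rcases st.2.eq_nil_or_concat' with h0 | ⟨l, c, hl⟩
      · simp only [h0, List.getLast?_nil, Option.getD_none]
        exact ⟨le_rfl, by exact_mod_cast hM⟩
      · rw [hl, List.getLast?_concat, Option.getD_some]
        exact hr c (by rw [hl]; simp)
    · exact hq x hx

/-- Along any run from `([], pmod M a)` with `M ≥ 1`, both components are reduced. [folklore] -/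
theorem reduced_divRun {M : ℕ} (hM : 0 < M) (a b : List ℤ) : ∀ u : List Unit,
    Reduced M (u.foldl (fun st _ => divStep M b st) ([], pmod M a)).1 ∧ Reduced M (u.foldl (fun st _ => divStep M b st) ([], pmod M a)).2 := by
  intro u
  induction u using List.reverseRecOn with
  | nil => exact ⟨fun _ h => by simp at h, reduced_pmod hM a⟩
  | append_singleton u x ih =>
    rw [List.foldl_append, List.foldl_cons, List.foldl_nil]
    exact reduced_divStep hM b ih.1 ih.2

/-- Arithmetic of the accumulator bound: a reduced list of length `≤ Lc` modulo `M⁺` with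
`size M ≤ Lc` codes in `≤ Lc (12 Lc + 18)` symbols. [folklore] -/
theorem length_code_le_of_reduced_max {M Lc : ℕ} {x : List ℤ} (hx : Reduced (max M 2) x) (hlen : x.length ≤ Lc)
    (hM : Nat.size M ≤ Lc) : (rawE intE x).length ≤ Lc * (12 * Lc + 18) := by
  refine (length_rawE_intE_le_of_reduced hx).trans ?_
  have h1 : Nat.size x.length ≤ Lc := (Nat.size_le.2 (Nat.lt_two_pow_self)).trans hlen
  have h2 := size_max_two_le M
  exact Nat.mul_le_mul hlen (by omega)

/-- **Division with remainder modulo `M⁺ = max M 2`** on codes: `(M, a, b) ↦ pdivmod M⁺ a b`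
(a fold over the unary budget `|a| + 1 - |b|`; accumulator `(q, r)` with `|q| + |r| = |a|` and
entries below `M⁺`, so its code is `≤ 60 (L+1)²`). [cite: KnuthTAOCP2, §4.6.1, Algorithm D] [cite: AroraBarak2009, §1.3] -/
theorem pdivmodC : CodeFP (pairE natE (pairE (rawE intE) (rawE intE))) (pairE (rawE intE) (rawE intE))
    (fun t => pdivmod (max t.1 2) t.2.1 t.2.2) := by
  -- context `σ = ((M, b), a)`, budget `1^{|a|+1-|b|}`; the step reduces modulo `max M 2`
  have hσ : CodeFP (pairE natE (pairE (rawE intE) (rawE intE))) (pairE (pairE natE (rawE intE)) (rawE intE))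
      (fun t => ((t.1, t.2.2), t.2.1)) :=
    ((fst _ _).pair (snd _ _).snd').pair (snd _ _).fst'
  have hbud : CodeFP (pairE natE (pairE (rawE intE) (rawE intE))) (rawE unitE)
      (fun t => List.replicate (t.2.1.length + 1 - t.2.2.length) ()) :=
    replicateUnit.comp ((unSubLen intE).comp ((unSucc.comp ((ulength intE).comp (snd _ _).fst')).pair (snd _ _).snd'))
  have hstep : CodeFP (pairE (pairE (pairE natE (rawE intE)) (rawE intE)) (pairE unitE (pairE (rawE intE) (rawE intE))))
      (pairE (rawE intE) (rawE intE)) (fun t => divStep (max t.1.1.1 2) t.1.1.2 t.2.2) :=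
    divStepC.comp (((maxTwoC.comp (fst _ _).fst'.fst').pair (fst _ _).fst'.snd').pair (snd _ _).snd')
  have hinit : CodeFP (pairE (pairE natE (rawE intE)) (rawE intE)) (pairE (rawE intE) (rawE intE))
      (fun s => (([] : List ℤ), pmod (max s.1.1 2) s.2)) :=
    (const _ ([] : List ℤ)).pair (pmodC.comp ((maxTwoC.comp (fst _ _).fst').pair (snd _ _)))
  have hfold := foldl (σ := (ℕ × List ℤ) × List ℤ) (α := Unit) (β := List ℤ × List ℤ)
    (eσ := pairE (pairE natE (rawE intE)) (rawE intE)) (eα := unitE) (eβ := pairE (rawE intE) (rawE intE))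
    (step := fun s _ st => divStep (max s.1.1 2) s.1.2 st) (init := fun s => ([], pmod (max s.1.1 2) s.2)) hstep hinit
    (60 * (X + 1) ^ 2) (fun s l₁ l₂ => by
      obtain ⟨⟨M, b⟩, a⟩ := s
      change (pairE (rawE intE) (rawE intE) (l₁.foldl (fun st (_ : Unit) => divStep (max M 2) b st) ([], pmod (max M 2) a))).length ≤ _
      set Lc := (pairE (pairE (pairE natE (rawE intE)) (rawE intE)) (rawE unitE) (((M, b), a), l₁ ++ l₂)).length with hLc
      set st := l₁.foldl (fun st (_ : Unit) => divStep (max M 2) b st) ([], pmod (max M 2) a) with hst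
      have hM2 : 0 < max M 2 := lt_of_lt_of_le (by norm_num) (le_max_right M 2)
      have hlen := length_divRun_le (max M 2) a b l₁
      have hred := reduced_divRun hM2 a b l₁
      rw [← hst] at hlen hred
      have hLa : a.length ≤ Lc := by
        rw [hLc]; simp only [pairE_apply, length_boolPair]
        have := length_le_code a; omega
      have hLu : l₁.length ≤ Lc := by
        rw [hLc]; simp only [pairE_apply, length_boolPair]
        have := length_le_length_rawE unitE (l₁ ++ l₂); rw [List.length_append] at this; omega
      have hLM : Nat.size M ≤ Lc := by
        rw [hLc]; simp only [pairE_apply, length_boolPair, length_natE]; omega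
      have hq := length_code_le_of_reduced_max hred.1 (hlen.2.trans hLu) hLM
      have hr := length_code_le_of_reduced_max hred.2 (hlen.1.trans hLa) hLM
      simp only [pairE_apply, length_boolPair, eval_mul, eval_pow, eval_add, eval_X, eval_ofNat, eval_one]
      nlinarith)
  refine ((hfold.comp (hσ.pair hbud)).congr fun t => ?_)
  obtain ⟨M, a, b⟩ := t
  rfl

/-- **`pmulM`** on codes (no iteration: `pnorm ∘ pmul`, polynomial for every modulus). [cite: AroraBarak2009, §1.3] -/
theorem pmulMC : CodeFP (pairE natE (pairE (rawE intE) (rawE intE))) (rawE intE) (fun t => pmulM t.1 t.2.1 t.2.2) :=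
  (pnormC.comp ((fst _ _).pair (pmulC.comp (snd _ _)))).congr fun _ => rfl

/-- **`pmodM` modulo `M⁺`** on codes: `(M, a, b) ↦ pmodM M⁺ a b`. [cite: AroraBarak2009, §1.3] -/
theorem pmodMC : CodeFP (pairE natE (pairE (rawE intE) (rawE intE))) (rawE intE) (fun t => pmodM (max t.1 2) t.2.1 t.2.2) :=
  (pnormC.comp ((maxTwoC.comp (fst _ _)).pair (pdivmodC.snd'))).congr fun _ => rfl

/-- Unconditional length of the remainder: `|(pdivmod M a b).2| ≤ |a|`. [folklore] -/
theorem length_pdivmod_snd_le (M : ℕ) (a b : List ℤ) : (pdivmod M a b).2.length ≤ a.length := by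
  have := (length_divRun_le M a b (List.replicate (a.length + 1 - b.length) ())).1
  rwa [← pdivmod] at this

/-- Unconditional length of the quotient: `|(pdivmod M a b).1| ≤ |a| + 1`. [folklore] -/
theorem length_pdivmod_fst_le (M : ℕ) (a b : List ℤ) : (pdivmod M a b).1.length ≤ a.length + 1 := by
  have := (length_divRun_le M a b (List.replicate (a.length + 1 - b.length) ())).2
  rw [← pdivmod, List.length_replicate] at this; omega

/-- Unconditional length of the remainder against a nonempty divisor: `|(pdivmod M a b).2| < |b|`. [folklore] -/
theorem length_pdivmod_snd_lt' (M : ℕ) (a : List ℤ) {b : List ℤ} (hb : b ≠ []) : (pdivmod M a b).2.length < b.length := by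
  have hbpos := List.length_pos_of_ne_nil hb
  -- the remainder length after `j ≤ |a| + 1 - |b|` steps is `|a| - j`
  have key : ∀ j : ℕ, j ≤ a.length + 1 - b.length →
      ((List.replicate j ()).foldl (fun st _ => divStep M b st) ([], pmod M a)).2.length = a.length - j := by
    intro j
    induction j with
    | zero => intro _; simp
    | succ j ih =>
      intro hj
      rw [List.replicate_succ', List.foldl_append, List.foldl_cons, List.foldl_nil]
      have hprev := ih (by omega)
      set st := (List.replicate j ()).foldl (fun st _ => divStep M b st) ([], pmod M a)
      rw [divStep, if_neg (by rw [hprev]; omega)]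
      simp only [List.length_dropLast, length_pmod, length_psub, SumcheckMA.length_pshift_pscale]
      rw [hprev]; omega
  by_cases hab : b.length ≤ a.length + 1
  · have := key (a.length + 1 - b.length) le_rfl
    rw [← pdivmod] at this; omega
  · have h0 : a.length + 1 - b.length = 0 := by omega
    have : pdivmod M a b = ([], pmod M a) := by rw [pdivmod, h0]; rfl
    rw [this]; simp only [length_pmod]; omega

/-- Unconditional length of `pmodM`: `< |b|` for `b ≠ []`, and `≤ |a|`. [folklore] -/
theorem length_pmodM_le' (M : ℕ) (a b : List ℤ) : (pmodM M a b).length ≤ a.length ∧ (b ≠ [] → (pmodM M a b).length < b.length) :=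
  ⟨(length_pnorm_le _).trans (length_pdivmod_snd_le M a b), fun hb => (length_pnorm_le _).trans_lt (length_pdivmod_snd_lt' M a hb)⟩

end LLLFactoring

end Literature.Computability.Complexity
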